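import Summits.NavierStokesRegularity.NavierStokesRegularity.Theorems.ScenarioCensusRowF1ThinTop
import HarnessLib

/-!
# LINE 29 «thin-top» port, part 2/3: §7 THE ROWS OF THE VOLUME AXIS — `Row_F1th` (apex, thin top) / `Row_F1vo` (evanescent top) / `Row_F1ps` (`r`-thin top), the floors
# `RecurrentFatSlices` / `PersistentFastSlice` / `DivergentThinness`, the residual `ThinSlack` (≡ `Row_F1`), the split, the verdicts (`rowF1th_holds`, `rowF1vo_holds`,
# `rowF1ps_holds`, floors), Leray's corner, orders inside the axis, must-succeed inhabitants

Re-homed for the scenario census (typer seat ns-census-typer-1 g9; the cells F1th / F1vo / F1ps (+ F1wk) and the floors are MEMBERS OF RECORD «DECIDED IN KERNEL IN FILES»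
of row F1 since census v1.92 (critic idea-crit-3 g8 PASS 06:25:46Z — no price; ref ns-census-ref g11 PRE-CHECK ✓ §16.23 item 56; lead-presearch label); this port
makes them TREE-decided): VERBATIM PORT of the NEW sections (§6–§9) of ns-idea-3 LINE 29 «thin-top», `pub/ideators/ns-idea-3/lines/thin-top/line-thin-top.lean` sha16
4cd0e2efd2dcc4d5 (1617 l., lean check rc 0, 0 sorry; its §1–§5 = LINE 27/28 VERBATIM, taken BY NAME from `ScenarioCensusRowF1Socket*` / `…SharpTop*`), split for the
400-line rule into `ScenarioCensusRowF1ThinTop` (§6) → `…ThinTopRows` (§7) → `…ThinTopVolume` (§8–§9 + census KEYS).  Lean text VERBATIM in namespace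
`…Theorems.ScenarioCensus.ThinTop` (the line's `…Cruxes.ScenarioCensusRowF1.ThinTopLine` re-homed) with `open …LiouvilleSocket …SharpTop`; port edits: the bracket lines
`section …` / `end …` dropped (no `variable`s), §8's VERBATIM restatement of LINE 27's `volIntegrand` / `Row_F1vol` / `volIntegrand_mono` / `rowF1vol_holds` not
re-declared (BY NAME), `@[conjecture]` on the residual `ThinSlack` (≡ `ScenarioCensus.Row_F1`, OPEN), one-line docstrings added where missing (gate lint).  Statements
untouched.

No census VALUE is moved here (row F1 stays OPEN-WITH-LINE; the members become TREE-decided by name); NS regularity is NOT proved; `Row_F1` is untouched (zero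
movement, `thinSlack_iff_rowF1`); no summit statement is proved by this file. Lemmas that restate already-landed tree declarations are taken BY NAME (gate lint `dedup.landed`): `fderiv_smul_stPull_apply` = `InviscidTop.fderiv_smul_stPull_apply`, `fderiv_smul_stPull` = `InviscidTop.fderiv_smul_stPull`, `fderiv_fderiv_smul_stPull` = `InviscidTop.fderiv_fderiv_smul_stPull`, `tendsto_clm_of_tendsto_apply` = `InviscidTop.tendsto_clm_of_tendsto_apply`, `tendsto_fderiv_fderiv_apply_of_bound` = `InviscidTop.tendsto_fderiv_fderiv_apply_of_bound`, `tendsto_fderiv_fderiv_of_bound` = `InviscidTop.tendsto_fderiv_fderiv_of_bound`, `tendsto_fderiv_fderiv_of_typeI_seq_Ioo` = `InviscidTop.tendsto_fderiv_fderiv_of_typeI_seq_Ioo`, `fderiv3_smul_stPull` = `FrozenTop.fderiv3_smul_stPull`, `tendsto_fderiv3_of_typeI_seq_Ioo` = `FrozenTop.tendsto_fderiv3_of_typeI_seq_Ioo`, `tendsto_physicalTime` = `ColumnarTop.tendsto_physicalTime`, `eventually_fast` = `ColumnarTop.eventually_fast`, `sqrt_timeLag` = `StretchedTop.sqrt_timeLag`,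 `forall_of_forall_ne_zero` = `StretchedTop.forall_of_forall_ne_zero`, `radius_eq` = `FrozenTop.radius_eq`, `jointCond_everywhere₆` = `FrozenTop.jointCond_everywhere₄`, `continuousOn_quad` = `IntegratedStretch.continuousOn_quad`, `sqrt_nu_timeLag` = `IntegratedStretch.sqrt_nu_timeLag`, `sing_of_not_bounded` = `InviscidTop.sing_of_not_bounded`, `exists_singularZoom_package₃` = `FrozenTop.exists_singularZoom_package₃`, `lapD_eq_zero_of_eq_zero` = `FrozenTop.lapD_eq_zero_of_eq_zero`, `measurableSet_top` = `IntegratedStretch.measurableSet_top`, `cross_smul_smul` = `UnthreadedRigidity.ThreadingJets.cross_smul_smul`.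
-/

-- the summit and its single problem share the name `NavierStokesRegularity` (D-0017 nested layout)
set_option linter.dupNamespace false

noncomputable section

open MeasureTheory Set Function Filter TopologicalSpace Metric
open scoped Topology NNReal ENNReal InnerProductSpace RealInnerProductSpace Laplacian

namespace Summit.NavierStokesRegularity.NavierStokesRegularity.Theorems.ScenarioCensus.ThinTop

open Literature.Analysis Literature.Analysis.FluidPDE
open Summit.NavierStokesRegularity.NavierStokesRegularity.Theorems
open Summit.NavierStokesRegularity.NavierStokesRegularity.Theorems.ScenarioCensus.LiouvilleSocket
open Summit.NavierStokesRegularity.NavierStokesRegularity.Theorems.ScenarioCensus.SharpTop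

/-! ## §7 THE ROWS OF THE VOLUME AXIS: the apex «THIN TOP» row `F1th` (scale-null fat times), its corollaries
«EVANESCENT TOP» `F1vo` (`Φ_κ(t) → 0`) and «`r`-THIN TOP» `F1ps` (`∫ Φ_κ^r dt/(T − t) < ∞`, any `r > 0`), Leray's
corner; the floors; the residual `ThinSlack ≡ Row_F1`; the split `rowF1_of`. -/

/-- **Criterion row F1th «THIN TOP»** (apex of the volume axis; order 0, explicit, magnitude-blind): the frame of `Row_F1`
plus — for some `κ < 1` and EVERY fatness `δ > 0`, the `δ`-fat times of the `κ`-fast slice,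
`{t : vol{x : |u(t,x)|² > κν/(T − t)} > δ (ν(T − t))^{3/2}}`, are NULL IN EVERY SCALE WINDOW at `T` — ⇒ smooth
extension.  Nothing is asked about HOW fast the fluid is on the fast slice, nor at the fat times.  PROVED (`rowF1th_holds`). -/
def Row_F1th : Prop :=
  ∀ (ν T : ℝ), 0 < ν → 0 < T → ∀ (u : ℝ → E3 → E3) (p : ℝ → E3 → ℝ),
    IsClassicalNSSolutionOn (Ico 0 T) ν 0 u p → IsLerayHopfOn T ν 0 (u 0) u →
    HasRapidSpatialDecay (u 0) → IsTypeIBlowup u T →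
    (∃ κ : ℝ, κ < 1 ∧ ∀ δ : ℝ, 0 < δ → IsScaleNull T (fatTimes T ν κ δ u)) →
    HasSmoothExtensionPast ν 0 u T

/-- **Criterion row F1vo «EVANESCENT TOP»**: the frame of `Row_F1` plus — for some `κ < 1` the volume fraction of the
`κ`-fast slice tends to zero, `vol{|u(t)|² > κν/(T − t)} = o((ν(T − t))^{3/2})` as `t ↑ T` — ⇒ smooth extension.
Leray's corner (`rowF1_subSelfSimilarSpeed`: the fast slice eventually EMPTY) is its `Φ ≡ 0` case.  PROVED. -/
def Row_F1vo : Prop :=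
  ∀ (ν T : ℝ), 0 < ν → 0 < T → ∀ (u : ℝ → E3 → E3) (p : ℝ → E3 → ℝ),
    IsClassicalNSSolutionOn (Ico 0 T) ν 0 u p → IsLerayHopfOn T ν 0 (u 0) u →
    HasRapidSpatialDecay (u 0) → IsTypeIBlowup u T →
    (∃ κ : ℝ, κ < 1 ∧ Tendsto (fastFraction T ν κ u) (𝓝[<] T) (𝓝 0)) →
    HasSmoothExtensionPast ν 0 u T

/-- **Criterion row F1ps «`r`-THIN TOP»** (the integrability-exponent family): the frame of `Row_F1` plus — for some
`κ < 1`, some exponent `r > 0` and some `t₀ < T`, `∫_{t₀}^{T} Φ_κ(t)^r dt/(T − t) < ∞` — ⇒ smooth extension.  Under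
Type I, `r = q/p = 2/(p − 3)` is the Prodi–Serrin reading `u·𝟙_{F^κ} ∈ L^q_t L^p_x`, `3/p + 2/q = 1`, `3 < p < ∞`;
`r = 1` is the hypothesis class of LINE 27's `Row_F1vol` (Tonelli).  Different `r` give pairwise NON-EQUIVALENT rows.
PROVED (`rowF1ps_holds`). -/
def Row_F1ps : Prop :=
  ∀ (ν T : ℝ), 0 < ν → 0 < T → ∀ (u : ℝ → E3 → E3) (p : ℝ → E3 → ℝ),
    IsClassicalNSSolutionOn (Ico 0 T) ν 0 u p → IsLerayHopfOn T ν 0 (u 0) u →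
    HasRapidSpatialDecay (u 0) → IsTypeIBlowup u T →
    (∃ κ r t₀ : ℝ, κ < 1 ∧ 0 < r ∧ t₀ < T ∧
      ∫⁻ t in Ioo t₀ T, fastFraction T ν κ u t ^ r / ENNReal.ofReal (T - t) < ⊤) →
    HasSmoothExtensionPast ν 0 u T

/-- **FAT FAST SLICES RECUR IN SOME SCALE WINDOW** (structural floor, maximal frame): at a maximal Type-I Clay blow-up,
for EVERY `κ < 1` there is a fatness `δ > 0` whose fat times are NOT null in every scale window — along some sequence
of windows `[T − λb, T − λa]`, `λ → 0`, a non-vanishing FRACTION of times carries a `κ`-fast slice of volume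
`> δ (ν(T − t))^{3/2}`.  PROVED (`recurrentFatSlices_holds`). -/
def RecurrentFatSlices : Prop :=
  ∀ (ν T : ℝ), 0 < ν → 0 < T → ∀ (u : ℝ → E3 → E3) (p : ℝ → E3 → ℝ),
    IsMaximalSmoothSolution ν 0 u p T → IsLerayHopfOn T ν 0 (u 0) u →
    HasRapidSpatialDecay (u 0) → IsTypeIBlowup u T →
    ∀ κ : ℝ, κ < 1 → ∃ δ : ℝ, 0 < δ ∧ ¬ IsScaleNull T (fatTimes T ν κ δ u)

/-- **THE FAST SLICE DOES NOT EVANESCE** (floor of F1vo): at a maximal Type-I Clay blow-up, for EVERY `κ < 1`,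
`vol{|u(t)|² > κν/(T − t)} / (ν(T − t))^{3/2} ↛ 0`.  PROVED. -/
def PersistentFastSlice : Prop :=
  ∀ (ν T : ℝ), 0 < ν → 0 < T → ∀ (u : ℝ → E3 → E3) (p : ℝ → E3 → ℝ),
    IsMaximalSmoothSolution ν 0 u p T → IsLerayHopfOn T ν 0 (u 0) u →
    HasRapidSpatialDecay (u 0) → IsTypeIBlowup u T →
    ∀ κ : ℝ, κ < 1 → ¬ Tendsto (fastFraction T ν κ u) (𝓝[<] T) (𝓝 0)

/-- **EVERY LOG-TIME `r`-MEAN OF THE FAST-SLICE FRACTION DIVERGES** (floor of F1ps): at a maximal Type-I Clay blow-up,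
for EVERY `κ < 1`, every `r > 0`, every `t₀ < T`: `∫_{t₀}^{T} Φ_κ^r dt/(T − t) = ∞` (Type-I reading: EVERY Prodi–Serrin
number of the near-self-similar-speed part `u·𝟙_{F^κ}` diverges).  PROVED. -/
def DivergentThinness : Prop :=
  ∀ (ν T : ℝ), 0 < ν → 0 < T → ∀ (u : ℝ → E3 → E3) (p : ℝ → E3 → ℝ),
    IsMaximalSmoothSolution ν 0 u p T → IsLerayHopfOn T ν 0 (u 0) u →
    HasRapidSpatialDecay (u 0) → IsTypeIBlowup u T →
    ∀ κ r t₀ : ℝ, κ < 1 → 0 < r → t₀ < T →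
      ∫⁻ t in Ioo t₀ T, fastFraction T ν κ u t ^ r / ENNReal.ofReal (T - t) = ⊤

/-- **The residual `ThinSlack`** (maximal frame): every maximal Type-I Clay blow-up has, for some `κ < 1`, scale-null
`δ`-fat times for every `δ > 0`.  EXACTLY `Row_F1` (`thinSlack_iff_rowF1`); no movement on `Row_F1` is claimed. -/
@[conjecture] def ThinSlack : Prop :=
  ∀ (ν T : ℝ), 0 < ν → 0 < T → ∀ (u : ℝ → E3 → E3) (p : ℝ → E3 → ℝ),
    IsMaximalSmoothSolution ν 0 u p T → IsLerayHopfOn T ν 0 (u 0) u →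
    HasRapidSpatialDecay (u 0) → IsTypeIBlowup u T →
    ∃ κ : ℝ, κ < 1 ∧ ∀ δ : ℝ, 0 < δ → IsScaleNull T (fatTimes T ν κ δ u)

/-- **The split**: the apex row and its slack give `Row_F1` (by cases on extendability). -/
theorem rowF1_of (hR : Row_F1th) (hS : ThinSlack) : ScenarioCensus.Row_F1 := by
  unfold ScenarioCensus.Row_F1
  intro ν T hν hT u p hsol hLH hdec hTI
  by_contra hext
  exact hext (hR ν T hν hT u p hsol hLH hdec hTI (hS ν T hν hT u p ⟨hsol, hext⟩ hLH hdec hTI))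

/-- `Row_F1` gives the slack vacuously (a maximal solution with an extension is a contradiction). -/
theorem thinSlack_of_rowF1 (h : ScenarioCensus.Row_F1) : ThinSlack :=
  fun ν T hν hT u p hmax hLH hdec hTI => absurd (h ν T hν hT u p hmax.1 hLH hdec hTI) hmax.2

/-! ### The apex row is EXCLUDED -/

/-- **Row F1th «THIN TOP» holds.**  Engine: non-extendability at some `x₀`
(`hasSmoothExtensionPast_of_forall_exists_parabolicCylinder`) → singular zoom with a non-trivial limit `W ∈ 𝒦_M`
(`FrozenTop.exists_singularZoom_package₃`) → the slice-volume transfer (`slow_everywhere_of_scaleNull`, at `κ₊ = max κ 0`) makes `W`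
`√κ₊`-slow everywhere → the imported threshold (`slow_ancient_trivial`) gives `W ≡ 0`: contradiction. -/
theorem rowF1th_holds : Row_F1th := by
  intro ν T hν hT u p hsol hLH hdec hTI h
  obtain ⟨κ, hκ, hnull⟩ := h
  obtain ⟨M, hM⟩ := exists_isTypeIBlowupWith hν hTI
  apply hasSmoothExtensionPast_of_forall_exists_parabolicCylinder hν hT hsol hLH hdec
  intro x₀
  by_contra hno
  obtain ⟨α, β, R, c, W, hα, hβ, hR, hαR, hαν, hcpos, hclim, hW, hpt, -, -, -, t, ht, y, hne⟩ :=
    FrozenTop.exists_singularZoom_package₃ hν hT hsol hLH hdec hM x₀ (InviscidTop.sing_of_not_bounded hno)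
  have hκ' : max κ 0 < 1 := max_lt hκ zero_lt_one
  have hnull' : ∀ δ : ℝ, 0 < δ → IsScaleNull T (fatTimes T ν (max κ 0) δ u) :=
    fun δ hδ => (hnull δ hδ).mono (fatTimes_anti (le_max_left κ 0) hν.le δ u)
  have hslow := slow_everywhere_of_scaleNull hν hT hW hα hβ hR hαR hαν hcpos hclim hpt (le_max_right κ 0) hnull'
  exact hne (slow_ancient_trivial hκ' hW hslow t ht y)

/-- **The floor FAT FAST SLICES RECUR holds.** -/
theorem recurrentFatSlices_holds : RecurrentFatSlices := by
  intro ν T hν hT u p hmax hLH hdec hTI κ hκ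
  by_contra hno
  push Not at hno
  exact hmax.2 (rowF1th_holds ν T hν hT u p hmax.1 hLH hdec hTI ⟨κ, hκ, hno⟩)

/-- The residual `ThinSlack` is EXACTLY `Row_F1`. -/
theorem thinSlack_iff_rowF1 : ThinSlack ↔ ScenarioCensus.Row_F1 :=
  ⟨fun h => rowF1_of rowF1th_holds h, thinSlack_of_rowF1⟩

/-- `Row_F1` from the residual alone (the apex row is proved). -/
theorem rowF1_of_thinSlack (h : ThinSlack) : ScenarioCensus.Row_F1 := rowF1_of rowF1th_holds h

/-! ### The EVANESCENT-TOP hypothesis is a thin top: `Φ_κ → 0` ⇒ every `δ`-fat set is eventually empty -/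

/-- An evanescent top is a thin top: `Φ_κ → 0` ⇒ every `δ`-fat set is eventually empty, hence scale-null. -/
theorem isScaleNull_fatTimes_of_tendsto_zero {T ν κ : ℝ} (hν : 0 < ν) (hT : 0 < T) {u : ℝ → E3 → E3}
    (h : Tendsto (fastFraction T ν κ u) (𝓝[<] T) (𝓝 0)) {δ : ℝ} (hδ : 0 < δ) :
    IsScaleNull T (fatTimes T ν κ δ u) := by
  -- eventually (in `𝓝[<] T`) the fraction is `< δ`, i.e. the time is NOT fat
  have hev : ∀ᶠ t in 𝓝[<] T, fastFraction T ν κ u t < ENNReal.ofReal δ :=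
    h (Iio_mem_nhds (ENNReal.ofReal_pos.2 hδ))
  obtain ⟨t₁, ht₁T, ht₁⟩ := (mem_nhdsLT_iff_exists_Ioo_subset).1 hev
  refine isScaleNull_of_subset_Iic (T := T) (t₁ := max t₁ 0) (max_lt ht₁T hT) ?_
  intro t ht
  by_contra hgt
  simp only [mem_Iic, not_le, max_lt_iff] at hgt
  have htT : t < T := ht.1.2
  have hlt : fastFraction T ν κ u t < ENNReal.ofReal δ := ht₁ ⟨hgt.1, htT⟩
  have hfat := ((mem_fatTimes_iff hν).1 ht).2
  exact absurd (hlt.trans hfat) (lt_irrefl _)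

/-- **Row F1vo «EVANESCENT TOP» follows from row F1th**, hence holds. -/
theorem rowF1vo_of_rowF1th (h : Row_F1th) : Row_F1vo := by
  intro ν T hν hT u p hsol hLH hdec hTI hyp
  obtain ⟨κ, hκ, hlim⟩ := hyp
  exact h ν T hν hT u p hsol hLH hdec hTI ⟨κ, hκ, fun δ hδ => isScaleNull_fatTimes_of_tendsto_zero hν hT hlim hδ⟩

/-- **Row F1vo holds** (evanescent top). -/
theorem rowF1vo_holds : Row_F1vo := rowF1vo_of_rowF1th rowF1th_holds

/-- **The floor THE FAST SLICE DOES NOT EVANESCE holds.** -/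
theorem persistentFastSlice_holds : PersistentFastSlice := by
  intro ν T hν hT u p hmax hLH hdec hTI κ hκ hlim
  exact hmax.2 (rowF1vo_holds ν T hν hT u p hmax.1 hLH hdec hTI ⟨κ, hκ, hlim⟩)

/-! ### The `r`-THIN hypothesis is a thin top: Chebyshev on scale windows + absolute continuity of the finite integral -/

/-- **`∫ Φ^r dt/(T − t) < ∞` ⇒ every `δ`-fat set is scale-null.**  On the window `[T − λb, T − λa]` a fat time has
`Φ^r/(T − t) ≥ δ^r/(λb)`, so `vol(fat ∩ window)/λ ≤ (b/δ^r) ∫_{window} Φ^r dt/(T − t) → 0` (tail of a finite integral: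
`tendsto_setLIntegral_zero`, the window has measure `λ(b − a) → 0`). -/
theorem isScaleNull_fatTimes_of_lintegral_lt_top {T ν κ r t₀ : ℝ} (hν : 0 < ν) {u : ℝ → E3 → E3} {p : ℝ → E3 → ℝ}
    (hsol : IsClassicalNSSolutionOn (Ico 0 T) ν 0 u p) (hr : 0 < r) (ht₀ : t₀ < T)
    (hfin : ∫⁻ t in Ioo t₀ T, fastFraction T ν κ u t ^ r / ENNReal.ofReal (T - t) < ⊤) {δ : ℝ} (hδ : 0 < δ) :
    IsScaleNull T (fatTimes T ν κ δ u) := by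
  intro a b ha hab
  have hb : 0 < b := ha.trans hab
  set μ : Measure ℝ := volume.restrict (Ioo t₀ T) with hμ
  set f : ℝ → ℝ≥0∞ := fun t => fastFraction T ν κ u t ^ r / ENNReal.ofReal (T - t) with hf
  -- the windows have `μ`-measure `→ 0`, so the window integrals of `f` tend to `0`
  have hwin : Tendsto (fun l : ℝ => μ (Icc (T - l * b) (T - l * a))) (𝓝[>] 0) (𝓝 0) := by
    have hup : ∀ l : ℝ, 0 < l → μ (Icc (T - l * b) (T - l * a)) ≤ ENNReal.ofReal (l * (b - a)) := by
      intro l hl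
      calc μ (Icc (T - l * b) (T - l * a)) ≤ volume (Icc (T - l * b) (T - l * a)) := Measure.restrict_le_self _
        _ = ENNReal.ofReal (l * (b - a)) := by rw [Real.volume_Icc]; congr 1; ring
    have h0 : Tendsto (fun l : ℝ => ENNReal.ofReal (l * (b - a))) (𝓝[>] 0) (𝓝 0) := by
      have h1 : Tendsto (fun l : ℝ => l * (b - a)) (𝓝 (0 : ℝ)) (𝓝 (0 * (b - a))) :=
        tendsto_id.mul_const _
      rw [zero_mul] at h1
      have h2 := (ENNReal.continuous_ofReal.tendsto 0).comp h1
      rw [ENNReal.ofReal_zero] at h2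
      exact h2.mono_left nhdsWithin_le_nhds
    refine tendsto_of_tendsto_of_tendsto_of_le_of_le' tendsto_const_nhds h0
      (Eventually.of_forall fun _ => bot_le) ?_
    exact eventually_nhdsWithin_of_forall fun l hl => hup l hl
  have htail : Tendsto (fun l : ℝ => ∫⁻ t in Icc (T - l * b) (T - l * a), f t ∂μ) (𝓝[>] 0) (𝓝 0) :=
    tendsto_setLIntegral_zero hfin.ne hwin
  -- Chebyshev on each small window
  have hmeas : MeasurableSet (fatTimes T ν κ δ u) := measurableSet_fatTimes hsol κ δ
  have hcheb : ∀ᶠ l in 𝓝[>] (0 : ℝ),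
      volume (fatTimes T ν κ δ u ∩ Icc (T - l * b) (T - l * a)) / ENNReal.ofReal l ≤
        (ENNReal.ofReal b * (ENNReal.ofReal δ ^ r)⁻¹) * ∫⁻ t in Icc (T - l * b) (T - l * a), f t ∂μ := by
    have hmem : Ioo (0 : ℝ) ((T - t₀) / b) ∈ 𝓝[>] (0 : ℝ) := Ioo_mem_nhdsGT (div_pos (sub_pos.2 ht₀) hb)
    filter_upwards [hmem] with l hl
    have hl0 : 0 < l := hl.1
    have hlb : l * b < T - t₀ := (lt_div_iff₀ hb).1 hl.2
    set A : Set ℝ := fatTimes T ν κ δ u ∩ Icc (T - l * b) (T - l * a) with hA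
    have hAm : MeasurableSet A := hmeas.inter measurableSet_Icc
    have hAsub : A ⊆ Icc (T - l * b) (T - l * a) ∩ Ioo t₀ T := by
      rintro t ⟨htf, htw⟩
      exact ⟨htw, by linarith [htw.1], htf.1.2⟩
    -- pointwise lower bound of `f` on `A`
    have hlow : ∀ t ∈ A, ENNReal.ofReal δ ^ r * (ENNReal.ofReal (l * b))⁻¹ ≤ f t := by
      rintro t ⟨htf, htw⟩
      have hfrac : ENNReal.ofReal δ < fastFraction T ν κ u t := ((mem_fatTimes_iff hν).1 htf).2
      have hnum : ENNReal.ofReal δ ^ r ≤ fastFraction T ν κ u t ^ r :=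
        ENNReal.rpow_le_rpow hfrac.le hr.le
      have hden : (ENNReal.ofReal (l * b))⁻¹ ≤ (ENNReal.ofReal (T - t))⁻¹ :=
        ENNReal.inv_le_inv.2 (ENNReal.ofReal_le_ofReal (by linarith [htw.1]))
      simp only [hf, div_eq_mul_inv]
      exact mul_le_mul' hnum hden
    have hint : ENNReal.ofReal δ ^ r * (ENNReal.ofReal (l * b))⁻¹ * volume A ≤
        ∫⁻ t in Icc (T - l * b) (T - l * a), f t ∂μ := by
      calc ENNReal.ofReal δ ^ r * (ENNReal.ofReal (l * b))⁻¹ * volume A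
          = ∫⁻ _ in A, ENNReal.ofReal δ ^ r * (ENNReal.ofReal (l * b))⁻¹ ∂volume := by
            rw [setLIntegral_const]
        _ ≤ ∫⁻ t in A, f t ∂volume := setLIntegral_mono' hAm hlow
        _ ≤ ∫⁻ t in Icc (T - l * b) (T - l * a) ∩ Ioo t₀ T, f t ∂volume := lintegral_mono_set hAsub
        _ = ∫⁻ t in Icc (T - l * b) (T - l * a), f t ∂μ := by
            rw [hμ, Measure.restrict_restrict measurableSet_Icc]
    -- rearrange: `vol(A)/l ≤ (b/δ^r) ∫`
    have hD0 : ENNReal.ofReal δ ^ r ≠ 0 := (ENNReal.rpow_pos (ENNReal.ofReal_pos.2 hδ) ENNReal.ofReal_ne_top).ne'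
    have hDt : ENNReal.ofReal δ ^ r ≠ ⊤ := ENNReal.rpow_ne_top_of_nonneg hr.le ENNReal.ofReal_ne_top
    have hb0' : ENNReal.ofReal b ≠ 0 := (ENNReal.ofReal_pos.2 hb).ne'
    have hl' : ENNReal.ofReal l ≠ 0 := (ENNReal.ofReal_pos.2 hl0).ne'
    calc volume A / ENNReal.ofReal l = (ENNReal.ofReal l)⁻¹ * volume A := by rw [div_eq_mul_inv, mul_comm]
      _ = (ENNReal.ofReal b * (ENNReal.ofReal δ ^ r)⁻¹) *
            (ENNReal.ofReal δ ^ r * (ENNReal.ofReal (l * b))⁻¹ * volume A) := by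
          rw [ENNReal.ofReal_mul hl0.le, ENNReal.mul_inv (Or.inl hl') (Or.inl ENNReal.ofReal_ne_top)]
          rw [show ENNReal.ofReal b * (ENNReal.ofReal δ ^ r)⁻¹ *
                (ENNReal.ofReal δ ^ r * ((ENNReal.ofReal l)⁻¹ * (ENNReal.ofReal b)⁻¹) * volume A)
              = ((ENNReal.ofReal δ ^ r)⁻¹ * ENNReal.ofReal δ ^ r) * (ENNReal.ofReal b * (ENNReal.ofReal b)⁻¹) *
                ((ENNReal.ofReal l)⁻¹ * volume A) by ring,
            ENNReal.inv_mul_cancel hD0 hDt, ENNReal.mul_inv_cancel hb0' ENNReal.ofReal_ne_top, one_mul, one_mul]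
      _ ≤ (ENNReal.ofReal b * (ENNReal.ofReal δ ^ r)⁻¹) * ∫⁻ t in Icc (T - l * b) (T - l * a), f t ∂μ :=
          mul_le_mul_right hint _
  -- squeeze
  have hC : ENNReal.ofReal b * (ENNReal.ofReal δ ^ r)⁻¹ ≠ ⊤ :=
    ENNReal.mul_ne_top ENNReal.ofReal_ne_top (ENNReal.inv_ne_top.2
      (ENNReal.rpow_pos (ENNReal.ofReal_pos.2 hδ) ENNReal.ofReal_ne_top).ne')
  have hup : Tendsto (fun l : ℝ => (ENNReal.ofReal b * (ENNReal.ofReal δ ^ r)⁻¹) *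
      ∫⁻ t in Icc (T - l * b) (T - l * a), f t ∂μ) (𝓝[>] 0) (𝓝 0) := by
    have h := ENNReal.Tendsto.const_mul htail (Or.inr hC)
    rw [mul_zero] at h
    exact h
  exact tendsto_of_tendsto_of_tendsto_of_le_of_le' tendsto_const_nhds hup
    (Eventually.of_forall fun _ => bot_le) hcheb

/-- **Row F1ps «`r`-THIN TOP» follows from row F1th**, hence holds. -/
theorem rowF1ps_of_rowF1th (h : Row_F1th) : Row_F1ps := by
  intro ν T hν hT u p hsol hLH hdec hTI hyp
  obtain ⟨κ, r, t₀, hκ, hr, ht₀, hfin⟩ := hyp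
  exact h ν T hν hT u p hsol hLH hdec hTI
    ⟨κ, hκ, fun δ hδ => isScaleNull_fatTimes_of_lintegral_lt_top hν hsol hr ht₀ hfin hδ⟩

/-- **Row F1ps holds** (`r`-thin top). -/
theorem rowF1ps_holds : Row_F1ps := rowF1ps_of_rowF1th rowF1th_holds

/-- **The floor EVERY LOG-TIME `r`-MEAN DIVERGES holds.** -/
theorem divergentThinness_holds : DivergentThinness := by
  intro ν T hν hT u p hmax hLH hdec hTI κ r t₀ hκ hr ht₀
  by_contra hne
  exact hmax.2 (rowF1ps_holds ν T hν hT u p hmax.1 hLH hdec hTI ⟨κ, r, t₀, hκ, hr, ht₀, lt_top_iff_ne_top.2 hne⟩)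

/-- The three floors together. -/
theorem thinFloors_holds : RecurrentFatSlices ∧ PersistentFastSlice ∧ DivergentThinness :=
  ⟨recurrentFatSlices_holds, persistentFastSlice_holds, divergentThinness_holds⟩

/-! ### Leray's corner in kernel: the fast slice eventually EMPTY (`Φ ≡ 0` near `T`) -/

/-- **Corner (Leray 1934 / census (L) pointwise form)**: Type I + for some `κ < 1` and `t₀ < T`, `|u(t, x)|² ≤ κν/(T − t)`
for all `t ∈ [t₀, T)` and all `x` ⇒ smooth extension — the `Φ_κ ≡ 0` case of row F1vo. -/
theorem rowF1_subSelfSimilarSpeed : ∀ (ν T : ℝ), 0 < ν → 0 < T → ∀ (u : ℝ → E3 → E3) (p : ℝ → E3 → ℝ),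
    IsClassicalNSSolutionOn (Ico 0 T) ν 0 u p → IsLerayHopfOn T ν 0 (u 0) u →
    HasRapidSpatialDecay (u 0) → IsTypeIBlowup u T →
    (∃ κ t₀ : ℝ, κ < 1 ∧ t₀ < T ∧ ∀ t ∈ Ico t₀ T, ∀ x, ‖u t x‖ ^ 2 ≤ κ * (ν * (T - t)⁻¹)) →
    HasSmoothExtensionPast ν 0 u T := by
  intro ν T hν hT u p hsol hLH hdec hTI h
  obtain ⟨κ, t₀, hκ, ht₀, hslow⟩ := h
  refine rowF1vo_holds ν T hν hT u p hsol hLH hdec hTI ⟨max κ 0, max_lt hκ zero_lt_one, ?_⟩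
  -- the `κ₊`-fast slice is empty on `[t₀, T)`, so the fraction is eventually `0`
  have hev : ∀ᶠ t in 𝓝[<] T, fastFraction T ν (max κ 0) u t = 0 := by
    filter_upwards [Ico_mem_nhdsLT ht₀] with t ht
    have hempty : fastSlice T ν (max κ 0) u t = ∅ := by
      ext x
      simp only [fastSlice, mem_setOf_eq, mem_empty_iff_false, iff_false, not_lt]
      rw [norm_le_critLevel_iff (le_max_right κ 0) hν.le ht.2]
      calc ‖u t x‖ ^ 2 ≤ κ * (ν * (T - t)⁻¹) := hslow t ht x
        _ ≤ max κ 0 * (ν * (T - t)⁻¹) :=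
          mul_le_mul_of_nonneg_right (le_max_left _ _) (mul_nonneg hν.le (inv_nonneg.2 (sub_pos.2 ht.2).le))
    simp only [fastFraction, hempty, measure_empty, ENNReal.zero_div]
  exact tendsto_const_nhds.congr' (EventuallyEq.symm hev)

/-! ### Orders inside the volume axis (hypothesis classes): F1th ⇒ F1vo, F1th ⇒ F1ps (proved above as implications of
rows).  `Row_F1vo` and `Row_F1ps`, and `Row_F1ps` for two different exponents, are NOT comparable by inclusion of
hypothesis classes (slowly evanescing fractions vs. sparse fat spikes); no comparison is claimed. -/

/-! ### MUST-SUCCEED inhabitants (sanity of the new definitions) -/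

/-- The identically-zero field has empty fast slices (the critical level is non-negative). -/
theorem fastSlice_zero (T ν κ t : ℝ) : fastSlice T ν κ (fun _ _ => (0 : E3)) t = ∅ := by
  ext x
  simp only [fastSlice, mem_setOf_eq, norm_zero, mem_empty_iff_false, iff_false, not_lt]
  exact critLevel_nonneg _ _ _ _

/-- The identically-zero field has no fat times (its slice volumes vanish). -/
theorem fatTimes_zero (T ν κ δ : ℝ) : fatTimes T ν κ δ (fun _ _ => (0 : E3)) = ∅ := by
  ext t
  simp only [fatTimes, mem_setOf_eq, mem_empty_iff_false, iff_false, not_and, not_lt]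
  intro _
  rw [fastSlice_zero, measure_empty]
  exact bot_le

end Summit.NavierStokesRegularity.NavierStokesRegularity.Theorems.ScenarioCensus.ThinTop

end
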